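import Summits.CriticalPhenomena.SAWScalingLimit.Theses.SAWCutPointCondensation
import Literature.Probability.RandomPlanarGeometry.BlobTimeDomainLaw
import Literature.Probability.RandomPlanarGeometry.SAWScalingLimitFamily
import Literature.Probability.RandomPlanarGeometry.ConformalRestrictionProofs

/-!
# Birth skeleton for crux `CondensateCovariance` (stmt-CriticalPhenomena-7347)

Route `SAWCutPointCondensation` of `CriticalPhenomena/SAWScalingLimit`, crux r3
`CondensateCovariance`: for every WINDOW FAMILY `Q` (the `δ → 0⁺` weak limits `Q g D` of the
critical blob-time laws `BL_{exp(-g δ^{3/4})}(Ω_δ; a_δ, b_δ)`) and every chordal, restriction,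
simple, boundary-avoiding `P` with `Q g D → P D` weakly as `g → ∞` on every approximable Dobrushin
domain, `P` is conformally covariant (`ChordalFamily.IsConformallyCovariant`).

## The line (the route's own foreseen split: "ProfileWindowLimit → ExactProfileCovariance →
ProfileUniversality → CondensateCovariance", route header TWO-LAYER PLAN), typed over the landed
definition `BlobTime.domainLawProfile` (site-dependent blob fugacity, pointwise whole-plane
critical; `BlobTimeDomainLaw.lean`).

Fix a conformal equivalence `g : D → D'` with the right boundary values and a continuous `Φ`
agreeing with `g` on `D`. The COUPLING PROFILE of the image model is
`ρ := |(g⁻¹)′|^{3/4}` on `D'` (`profile g`): the cut-point content transforms as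
`d𝓜′ = |φ′|^{3/4} d𝓜` and Brownian duration as `dτ′ = |φ′|² dτ`, and `(3/4)·(8/3) = 2` turns the
profile of the coupling into the profile of the critical killing, so the image of the
constant-coupling window law is the POINTWISE-CRITICAL `ρ`-modulated window law — no counterterm.
On the lattice the `ρ`-model at window coupling `g'` and mesh `δ` is
`BL_τ(Ω'_δ; a'_δ, b'_δ)` with site fugacity `τ(x) = exp(-g' ρ(δx) δ^{3/4})`
(`profileFugacity ρ g' δ`, law `BlobTime.domainLawProfile τ Ω' δ a' b'`).

* `stub_profileWindowLimit`  — (W_ρ) the profile window limit EXISTS on the image domain: there is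
  `R : ℝ → Measure (CurveClass ℂ)` with `R g'` a probability measure and
  `BL_{τ}(Ω'_δ; a'_δ, b'_δ) ⇒ R g'` as `δ → 0⁺` for every endpoint approximation of `D'` and every
  `g' > 0` (`IsProfileWindowLaw (profile g) D' R`). Size XL (GLPS-type convergence of an
  inhomogeneously tilted pinned excursion; tightness uniform in the profile near `a'`, `b'`).
* `stub_exactProfileCovariance` — (E) conformal CLOSURE of the window class: every profile window
  law `R` of `ρ = profile g` on `D'` is the conformal image of the window family,
  `R g' = Φ_* (Q g' D)` for `g' > 0`. Size XL (identification of both window limits as excursion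
  tilts + covariance of excursion / cut-point content / clock; exact because `θ_c(s) = κ₀ s^{8/3}`
  by zoom covariance).
* `stub_profileUniversality` — (U_ρ) PROFILE UNIVERSALITY = irrelevance of the bare value of a
  relevant coupling: `∫ f dR g' - ∫ f d(Q g' D') → 0` as `g' → ∞` for every bounded continuous `f`
  (difference form: no limit is presupposed). Size XL / open; the HARDEST stub and the declared
  failure mode of the crux (`|ψ′|` degenerates at the marked points and at rough prime ends; a
  marginal response to `∇ log ρ` would leave a profile memory).

`CondensateCovariance_of : Registered.stub_profileWindowLimit → Registered.stub_exactProfileCovariance →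
Registered.stub_profileUniversality → CondensateCovariance` (name-keyed abbrevs of the three stub
statements `ProfileWindowLimit`, `ExactProfileCovariance`, `ProfileUniversality`) is a real proof (≈ 35 lines): every Dobrushin domain is approximable
(tree theorem `SAW.exists_isEndpointApprox`), so `Q g' D → P D` and `Q g' D' → P D'`; for a
bounded continuous `f`, `f ∘ CurveClass.map Φ` is bounded continuous (`CurveClass.continuous_map`)
so `∫ f dR g' = ∫ f∘(map Φ) dQ g' D → ∫ f dΦ_*(P D)` (E), while (U_ρ) and uniqueness of limits
along `atTop` give `∫ f dΦ_*(P D) = ∫ f dP D'`; a finite Borel measure on the metric space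
`CurveClass ℂ` is determined by such integrals
(`MeasureTheory.ext_of_forall_integral_eq_of_IsFiniteMeasure`). The hypotheses `P.IsRestriction`
and simplicity of `P` are not consumed by this line (they are consumed by `closes` through
LSW 2003); the window hypothesis on `Q` is `IsWindowFamily Q`, definitionally the crux's clause
(`BlobTime.domainLaw_eq` is `rfl`).

Disproof used: none exists for this crux yet (`ledger crux ls stmt-CriticalPhenomena-7347`: no
workfiles, no `Disproof.lean`, no Negative lemmas); negatives index (11 entries, 2026-08-17): only
stmt-0772 (tightness for ALL `δ ∈ (0,1]`) is in this sub-problem's vicinity — every filter here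
is eventual (`𝓝[>] 0`, `atTop`). Dead lines: none recorded for this crux.

BC3 probes (planner folder `bc/probe_*.lean`, defs copied verbatim, no stubs in scope): for each
stub `S`, `S → CondensateCovariance` and `S → SAWScalingLimit` by
`first | exact? | simpa | aesop` FAIL (see NOTES.md of planner-skel-stmt-CriticalPhenomena-7347-0
for the raw outputs).
-/

noncomputable section

namespace Summit.CriticalPhenomena.SAWScalingLimit.Cruxes.CondensateCovariance.Birth

open MeasureTheory Filter Topology Set
open scoped ENNReal NNReal
open Literature.Probability.RandomPlanarGeometry
open Literature.Probability.LatticeModels (Site meshPoint)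
open Summit.CriticalPhenomena.SAWScalingLimit.Theses.SAWCutPointCondensation

-- BEGIN DEFS
/-- `Q` is a WINDOW FAMILY: for every `g > 0`, `Q g` is chordal and `Q g D` is the `δ → 0⁺` weak
limit (identity observable) of the critical blob-time laws `BL_{exp(-g δ^{3/4})}(Ω_δ; a_δ, b_δ)`
along every endpoint approximation of every Dobrushin domain. Definitionally the hypothesis
clause of `CondensateCovariance` / `CondensationLimit` (`BlobTime.domainLaw_eq` is `rfl`). -/
def IsWindowFamily (Q : ℝ → ChordalFamily) : Prop :=
  ∀ g : ℝ, 0 < g → (Q g).IsChordal ∧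
    ∀ (D : DobrushinDomain) (a b : ℝ → Site 2), SAW.IsEndpointApprox D a b →
      TendstoLaw (fun (_ : ℝ) (x : CurveClass ℂ) => x)
        (fun δ => BlobTime.domainLaw (Real.exp (-(g * δ ^ (3 / 4 : ℝ)))) D.carrier δ (a δ) (b δ))
        id ((Q g) D)

/-- The COUPLING PROFILE on the image domain of a conformal equivalence `g : D → D'`:
`ρ(y) = |(g⁻¹)′(y)|^{3/4}` (`3/4 = 2 - ξ(1,1)`, the dimension of the Brownian cut points: the
cut-point content transforms as `d𝓜′ = |φ′|^{3/4} d𝓜`). Junk outside `D'`. -/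
def profile {D D' : DobrushinDomain} (g : ConformalEquiv D.carrier D'.carrier) : ℂ → ℝ :=
  fun y => ‖deriv (fun z => g.symm z) y‖ ^ (3 / 4 : ℝ)

/-- The site-dependent blob fugacity of the `ρ`-modulated window model at coupling `g'` and mesh
`δ`: `τ(x) = exp(-g' ρ(δ x) δ^{3/4})` (constant profile `ρ ≡ 1` gives the window fugacity
`exp(-g' δ^{3/4})`). -/
def profileFugacity (ρ : ℂ → ℝ) (g' δ : ℝ) : Site 2 → ℝ :=
  fun x => Real.exp (-(g' * ρ (meshPoint δ x) * δ ^ (3 / 4 : ℝ)))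

/-- `R` is a PROFILE WINDOW LAW for the profile `ρ` on the Dobrushin domain `D'`: for every
`g' > 0`, `R g'` is a probability measure and the pointwise-critical profile blob-time laws
`BlobTime.domainLawProfile (profileFugacity ρ g' δ) Ω' δ a'_δ b'_δ` converge weakly to `R g'` as
`δ → 0⁺` along every endpoint approximation `(a', b')` of `D'`. -/
def IsProfileWindowLaw (ρ : ℂ → ℝ) (D' : DobrushinDomain) (R : ℝ → Measure (CurveClass ℂ)) :
    Prop :=
  ∀ g' : ℝ, 0 < g' → IsProbabilityMeasure (R g') ∧
    ∀ (a b : ℝ → Site 2), SAW.IsEndpointApprox D' a b →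
      TendstoLaw (fun (_ : ℝ) (x : CurveClass ℂ) => x)
        (fun δ => BlobTime.domainLawProfile (profileFugacity ρ g' δ) D'.carrier δ (a δ) (b δ))
        id (R g')

/-- (W_ρ) PROFILE WINDOW LIMIT: for every conformal equivalence of Dobrushin domains `g : D → D'`
with boundary values `a ↦ a'`, `b ↦ b'`, the `profile g`-modulated window model on `D'` has a
window limit. -/
def ProfileWindowLimit : Prop :=
  ∀ (D D' : DobrushinDomain) (g : ConformalEquiv D.carrier D'.carrier),
    g.HasBoundaryValue (D.pt 0) (D'.pt 0) → g.HasBoundaryValue (D.pt 1) (D'.pt 1) →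
      ∃ R : ℝ → Measure (CurveClass ℂ), IsProfileWindowLaw (profile g) D' R

/-- (E) EXACT PROFILE COVARIANCE — the pointwise-critical tilts form a conformally CLOSED class
with no counterterm (`(3/4)·(8/3) = 2`): the conformal image `Φ_* (Q g' D)` of the window law IS
the `profile g`-window law of the image domain, for every `g' > 0`. -/
def ExactProfileCovariance : Prop :=
  ∀ Q : ℝ → ChordalFamily, IsWindowFamily Q →
    ∀ (D D' : DobrushinDomain) (g : ConformalEquiv D.carrier D'.carrier) (Φ : C(ℂ, ℂ)),
      g.HasBoundaryValue (D.pt 0) (D'.pt 0) → g.HasBoundaryValue (D.pt 1) (D'.pt 1) →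
        Set.EqOn Φ g D.carrier →
          ∀ R : ℝ → Measure (CurveClass ℂ), IsProfileWindowLaw (profile g) D' R →
            ∀ g' : ℝ, 0 < g' → R g' = (Q g' D).map (CurveClass.map Φ)

/-- (U_ρ) PROFILE UNIVERSALITY — the bare value of a RELEVANT coupling is forgotten in the
infrared: the `profile g`-window laws and the constant-profile window laws of `D'` are
asymptotically equal in law as `g' → ∞` (difference form, bounded continuous test functions). -/
def ProfileUniversality : Prop :=
  ∀ Q : ℝ → ChordalFamily, IsWindowFamily Q →
    ∀ (D D' : DobrushinDomain) (g : ConformalEquiv D.carrier D'.carrier),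
      g.HasBoundaryValue (D.pt 0) (D'.pt 0) → g.HasBoundaryValue (D.pt 1) (D'.pt 1) →
        ∀ R : ℝ → Measure (CurveClass ℂ), IsProfileWindowLaw (profile g) D' R →
          ∀ f : BoundedContinuousFunction (CurveClass ℂ) ℝ,
            Tendsto (fun g' : ℝ => ∫ x, f x ∂(R g') - ∫ x, f x ∂(Q g' D')) atTop (𝓝 0)
-- END DEFS

/-! ### Registered stubs -/

/-- stub 1 (W_ρ): the profile window limit exists on the image domain. Plausibly XL
(GLPS 2026 Thm 1.1-type convergence for an inhomogeneously tilted excursion pinned at prime ends;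
tightness uniform in the profile's boundary behaviour). -/
theorem stub_profileWindowLimit : ProfileWindowLimit := by
  sorry

/-- stub 2 (E): exact profile covariance — the conformal image of the window law is the profile
window law of the image domain. Plausibly XL (identification of both window limits as normalised
excursion tilts `exp(g' c₁ ∫ρ d𝓜 - κ₀ ∫ (g'ρ)^{8/3} dτ) μ^{exc}`; covariance of the Brownian
excursion, of the cut-point Minkowski content and of the clock; `θ_c(s) = κ₀ s^{8/3}`). -/
theorem stub_exactProfileCovariance : ExactProfileCovariance := by
  sorry

/-- stub 3 (U_ρ, HARDEST): profile universality — conformal (log-harmonic, positive) coupling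
profiles are forgotten as `g' → ∞`: the local crossover scale `(g'ρ)^{-4/3} → 0` on compacts of
`D'`; at `a'`, `b'` and rough prime ends `ρ` may degenerate (the crux's declared risk). -/
theorem stub_profileUniversality : ProfileUniversality := by
  sorry

/-! ### Name-keyed aliases of the three stub statements (hypotheses of the composition)

`Registered.stub_X` is the statement of `stub_X` under the registered stub's short name, so that the
native skeleton audit (hypotheses admissible iff registered obligations / declared stubs BY NAME)
accepts `CondensateCovariance_of : Registered.stub_… → … → CondensateCovariance` (same device as
`Cruxes/BoundaryClosure/Lines/two-root-quotient.lean`). -/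
namespace Registered

/-- Alias keyed by the registered stub name. -/
abbrev stub_profileWindowLimit : Prop := ProfileWindowLimit
/-- Alias keyed by the registered stub name. -/
abbrev stub_exactProfileCovariance : Prop := ExactProfileCovariance
/-- Alias keyed by the registered stub name. -/
abbrev stub_profileUniversality : Prop := ProfileUniversality

end Registered

/-! ### The kernel-checked composition -/

/-- **`CondensateCovariance` from the three stubs.** Approximability of every Dobrushin domain
(`SAW.exists_isEndpointApprox`, a tree theorem) turns the crux's convergence hypothesis into
`Q g' D → P D`, `Q g' D' → P D'`; (W_ρ) gives a profile window law `R`, (E) identifies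
`R g' = Φ_*(Q g' D)` for `g' > 0`, (U_ρ) makes `∫ f dR g' - ∫ f dQ g' D' → 0`; uniqueness of limits
along `atTop` and `ext_of_forall_integral_eq_of_IsFiniteMeasure` (Billingsley 1999 Thm 1.2) give
`P D' = Φ_*(P D)`. -/
theorem CondensateCovariance_of (hWρ : Registered.stub_profileWindowLimit)
    (hE : Registered.stub_exactProfileCovariance) (hU : Registered.stub_profileUniversality) :
    Summit.CriticalPhenomena.SAWScalingLimit.Theses.SAWCutPointCondensation.CondensateCovariance := by
  intro Q P hQ hPch _hPres _hPsimp hPlim D D' g Φ hbv0 hbv1 hEq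
  -- the crux's window clause is `IsWindowFamily Q` (`BlobTime.domainLaw_eq` is `rfl`)
  have hW : IsWindowFamily Q := hQ
  -- (W_ρ): a profile window law on the image domain
  obtain ⟨R, hR⟩ := hWρ D D' g hbv0 hbv1
  -- (E): it is the conformal image of the window family
  have hcov : ∀ g' : ℝ, 0 < g' → R g' = (Q g' D).map (CurveClass.map Φ) :=
    hE Q hW D D' g Φ hbv0 hbv1 hEq R hR
  -- (U_ρ): and it is asymptotically equal in law to the window family of the image domain
  have huniv := hU Q hW D D' g hbv0 hbv1 R hR
  -- every Dobrushin domain is approximable (tree theorem)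
  obtain ⟨a, b, hab⟩ := SAW.exists_isEndpointApprox D
  obtain ⟨a', b', hab'⟩ := SAW.exists_isEndpointApprox D'
  haveI : IsProbabilityMeasure (P D) := (hPch D).1
  haveI : IsProbabilityMeasure (P D') := (hPch D').1
  have hΦm : Measurable (CurveClass.map Φ) := CurveClass.measurable_map Φ
  haveI : IsProbabilityMeasure ((P D).map (CurveClass.map Φ)) :=
    Measure.isProbabilityMeasure_map hΦm.aemeasurable
  refine ext_of_forall_integral_eq_of_IsFiniteMeasure fun f => ?_
  rw [integral_map hΦm.aemeasurable f.continuous.aestronglyMeasurable]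
  -- the composed test function `f ∘ CurveClass.map Φ`
  set fΦ : BoundedContinuousFunction (CurveClass ℂ) ℝ :=
    f.compContinuous ⟨CurveClass.map Φ, CurveClass.continuous_map Φ⟩ with hfΦ
  have hu : Tendsto (fun g' : ℝ => ∫ x, fΦ x ∂(Q g' D)) atTop (𝓝 (∫ x, fΦ x ∂(P D))) :=
    hPlim D a b hab fΦ
  have hv : Tendsto (fun g' : ℝ => ∫ x, f x ∂(Q g' D')) atTop (𝓝 (∫ x, f x ∂(P D'))) :=
    hPlim D' a' b' hab' f
  -- `∫ f dR g' = ∫ fΦ dQ g' D` for `g' > 0`, by (E)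
  have hRint : ∀ᶠ g' : ℝ in atTop, ∫ x, fΦ x ∂(Q g' D) = ∫ x, f x ∂(R g') := by
    filter_upwards [eventually_gt_atTop (0 : ℝ)] with g' hg'
    rw [hcov g' hg', integral_map hΦm.aemeasurable f.continuous.aestronglyMeasurable]
    simp [hfΦ]
  have hu' : Tendsto (fun g' : ℝ => ∫ x, f x ∂(R g')) atTop (𝓝 (∫ x, fΦ x ∂(P D))) :=
    hu.congr' hRint
  -- uniqueness of limits along `atTop`
  have hsub : Tendsto (fun g' : ℝ => ∫ x, f x ∂(R g') - ∫ x, f x ∂(Q g' D')) atTop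
      (𝓝 (∫ x, fΦ x ∂(P D) - ∫ x, f x ∂(P D'))) := hu'.sub hv
  have heq : ∫ x, fΦ x ∂(P D) - ∫ x, f x ∂(P D') = 0 := tendsto_nhds_unique hsub (huniv f)
  have hfΦ' : ∫ x, fΦ x ∂(P D) = ∫ x, f (CurveClass.map Φ x) ∂(P D) := by
    simp [hfΦ]
  linarith [sub_eq_zero.1 heq]

/-- Wiring check: the registered stubs feed `CondensateCovariance_of` as stated (this `example`
is the only consumer of the `sorry`s). -/
example : Summit.CriticalPhenomena.SAWScalingLimit.Theses.SAWCutPointCondensation.CondensateCovariance :=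
  CondensateCovariance_of stub_profileWindowLimit stub_exactProfileCovariance stub_profileUniversality

end Summit.CriticalPhenomena.SAWScalingLimit.Cruxes.CondensateCovariance.Birth

end
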